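import Summits.HubbardSuperconductivity.HubbardLadder.NeelSignPatternC11
import Summits.HubbardSuperconductivity.HubbardLadder.NeelSignPatternC02S
import Summits.HubbardSuperconductivity.HubbardLadder.NeelSignPatternC12S
import Summits.HubbardSuperconductivity.HubbardLadder.NeelSignPatternC03
import Summits.HubbardSuperconductivity.HubbardLadder.NeelRPFreeCorrelationRowsFourA
import Summits.HubbardSuperconductivity.HubbardLadder.NeelRPFreeCorrelationRowsFourB
import Summits.HubbardSuperconductivity.HubbardLadder.NeelRPFreeCorrelationRowsFourC
import Summits.HubbardSuperconductivity.HubbardLadder.NeelRPFreeCorrelationRowsSixA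
import Summits.HubbardSuperconductivity.HubbardLadder.NeelRPFreeCorrelationRowsSixB
import Summits.HubbardSuperconductivity.HubbardLadder.NeelRPFreeCorrelationRowsSixC
import Summits.HubbardSuperconductivity.HubbardLadder.NeelRPFreeCorrelationRowsSixF
import Summits.HubbardSuperconductivity.HubbardLadder.NeelRPFreeCorrelationRowsEightA
import Summits.HubbardSuperconductivity.HubbardLadder.NeelRPFreeCorrelationRowsEightB
import Summits.HubbardSuperconductivity.HubbardLadder.NeelRPFreeCorrelationRowsEightC
import Summits.HubbardSuperconductivity.HubbardLadder.NeelRPFreeCorrelationRowsEightE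
import Summits.HubbardSuperconductivity.HubbardLadder.NeelRPFreeCorrelationRowsTenA
import Summits.HubbardSuperconductivity.HubbardLadder.NeelRPFreeCorrelationRowsTenB
import Summits.HubbardSuperconductivity.HubbardLadder.NeelRPFreeCorrelationRowsTenC
import Summits.HubbardSuperconductivity.HubbardLadder.NeelRPFreeCorrelationRowsTenF
import Summits.HubbardSuperconductivity.HubbardLadder.NeelRPFreeCorrelationRowsTwelveA
import Summits.HubbardSuperconductivity.HubbardLadder.NeelRPFreeCorrelationRowsTwelveB
import Summits.HubbardSuperconductivity.HubbardLadder.NeelRPFreeCorrelationRowsTwelveC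
import Summits.HubbardSuperconductivity.HubbardLadder.NeelRPFreeCorrelationRowsTwelveF
import Literature.MathematicalPhysics.QuantumLattice.HeisenbergOrderNeelProofs
import HarnessLib

/-!
# R2 device D42 (assembly) — the strict Néel sign pattern at `|a|+|b| ≤ 3` on EVERY even torus, energy-free, with `L`-uniform margins

HONEST FRAMING: ladder R1–R4 with certified numbers; no claim on H/H₀.

Glue only (no new certificate in this file): for the spin-½ Heisenberg antiferromagnet on the `L×L` torus, `L ≥ 4`
even, tracial ground state, the `D₄`-reduced two-point function `c_L(a,b) = ⟨Sˣ_0 Sˣ_(a,b)⟩ = ⅓⟨𝐒_0·𝐒_(a,b)⟩`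
(`heisRedCorr2 L 1 a b`) has the STRICT alternating (Néel) sign `(-1)^(a+b) c_L(a,b) > 0` at every displacement
class with `1 ≤ |a|+|b| ≤ 3` — `(0,1)`, `(1,1)`, `(0,2)`, `(1,2)`, `(0,3)` — with explicit `L`-UNIFORM margins and
NO hypothesis (no energy input, no numerical input):
**`c_L(0,1) ≤ -1/12`, `c_L(1,1) ≥ 173/10000`, `c_L(0,2) ≥ 37/10000`, `c_L(1,2) ≤ -41/10000`, `c_L(0,3) ≤ -17/10000`
for EVERY even `L ≥ 4`** (`heisRedCorr2_C01_ceiling_allEven`, `heisRedCorr2_C11_floor_allEven`,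
`heisRedCorr2_C02_floor_allEven`, `heisRedCorr2_C12_ceiling_allEven`, `heisRedCorr2_C03_ceiling_allEven`; conjunction
`neelSignPattern_allEven`). Assembled from: the Néel variational bound `ε ≤ -1/12` (`heisBondCorr_le`,
Kennedy–Lieb–Shastry 1988 p. 1022); the `L`-uniform window-kernel theorems for every even `L ≥ 14` of devices D40
(`heisRedCorr2_C11_floor`, `119/5000`), D41 (`heisRedCorr2_C02_floor`, `37/10000`; `heisRedCorr2_C12_ceiling`, `-41/10000`)
and D39 (`heisRedCorr2_C03_sign`, `-11/5000`); the energy-free `12×12` rows of device D30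
(`heisRedCorr2_twelve_1_1_ge_free` `0.0266`, `heisRedCorr2_twelve_0_2_ge_free` `0.0101`, `heisRedCorr2_twelve_1_2_le_free`
`-0.0081`); and the small-torus energy-free rows of device D42 (`NeelRPFreeCorrelationRows{FourA–C,SixA–C,SixF,EightA–C,
EightE,TenA–C,TenF,TwelveF}.lean`: `L = 4`: `0.0289`, `0.0114`, `-0.0088`; `L = 6`: `0.0269`, `0.0044`, `-0.0086`, `-0.0107`;
`L = 8`: `0.0173`, `0.0063`, `-0.0044`, `-0.0017`; `L = 10` (Galois-paired `ℚ(√5)` programme): `0.0270`, `0.0092`, `-0.0085`,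
`-0.0060`; `L = 12`: `c(0,3) ≤ -0.0058`); at `L = 4` the class `(0,3)` IS the bond class `(0,1)` (`heisRedCorr2_symmD4_four`).
The uniform margins are the minima over the parts (attained at `L = 8`, `L ≥ 14`, `L ≥ 14`, `L = 8` respectively); the
previous all-even diagonal constant `3/250` (device D35, `heisRedCorr2_diag_lower_allEven`) is thereby raised to `173/10000`.
The Marshall–Lieb–Mattis sign rule alone gives only the WEAK signs. The `|a|+|b| = 4` classes `(2,2)`, `(1,3)` are
strictly signed on the finite tori `6 ≤ L ≤ 12` only (`NeelRPFreeCorrelationRows{SixD,SixE,EightD,TenD,TenE,TwelveD,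
TwelveE}.lean`), no `L`-uniform certificate being available there (the kernel-free `L`-uniform programme is negative:
`EXPLORE4.md`/`EXPLORE5.md` of devices D40/D41). A statement about every finite even torus, uniform in `L`; NOT a
statement about long-range order, and nothing about `L → ∞` beyond what the uniform constants say.
[cite: KLS1988JSP, eqs. (1), (4), (6)–(9), (12)–(25), p. 1022] [cite: DLS1978, Theorem 4.2] [cite: Marshall1955, sign rule]
[cite: LiebMattis1962, Theorem 2]
-/

noncomputable section

open Literature.MathematicalPhysics.QuantumLattice Literature.Probability.LatticeModels

namespace Summit.HubbardSuperconductivity.HubbardLadder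

/-- **`c_L(0,1) = ε_L ≤ -1/12` for EVERY even `L ≥ 4`** — the Néel variational bound `heisBondCorr_le` in reduced
coordinates (`ε = (c(1,0)+c(0,1))/2`, `c(1,0) = c(0,1)`). HONEST FRAMING: ladder R1–R4 with certified numbers; no claim on H/H₀.
[cite: KLS1988JSP, p. 1022] [cite: DLS1978, App. C] -/
theorem heisRedCorr2_C01_ceiling_allEven (L : ℕ) (hL : 4 ≤ L) (hev : Even L) :
    heisRedCorr2 L 1 0 1 ≤ -(1 / 12 : ℝ) := by
  obtain ⟨k, rfl⟩ := hev
  haveI : NeZero (2 * k) := ⟨by omega⟩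
  have hε := heisBondCorr_le (d := 2) (by norm_num) 1 k (by omega)
  rw [heisBondCorr_two_eq, heisRedCorr2_swap (2 * k) 1 1 0] at hε
  rw [← two_mul]
  norm_num at hε ⊢
  linarith

/-- **`c_L(1,1) ≥ 173/10000 = 0.0173` for EVERY even `L ≥ 4`** (energy-free; `L = 4, …, 12` from the finite rows
`0.0289`, `0.0269`, `0.0173`, `0.0270`, `0.0266`, `L ≥ 14` from the D40 kernel theorem `heisRedCorr2_C11_floor`, `119/5000`);
raises the D35 all-even constant `3/250`. HONEST FRAMING: ladder R1–R4 with certified numbers; no claim on H/H₀.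
[cite: KLS1988JSP, eqs. (1), (4), (12)–(25)] [cite: DLS1978, Theorem 4.2] -/
theorem heisRedCorr2_C11_floor_allEven (L : ℕ) (hL : 4 ≤ L) (hev : Even L) :
    (173 / 10000 : ℝ) ≤ heisRedCorr2 L 1 1 1 := by
  obtain ⟨k, rfl⟩ := hev
  rcases Nat.lt_or_ge (k + k) 14 with h14 | h14
  · have hk : k = 2 ∨ k = 3 ∨ k = 4 ∨ k = 5 ∨ k = 6 := by omega
    rcases hk with rfl | rfl | rfl | rfl | rfl
    · exact le_trans (by norm_num) heisRedCorr2_four_1_1_ge_free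
    · exact le_trans (by norm_num) heisRedCorr2_six_1_1_ge_free
    · exact le_trans (by norm_num) heisRedCorr2_eight_1_1_ge_free
    · exact le_trans (by norm_num) heisRedCorr2_ten_1_1_ge_free
    · exact le_trans (by norm_num) heisRedCorr2_twelve_1_1_ge_free
  · rw [← two_mul]
    exact le_trans (by norm_num) (heisRedCorr2_C11_floor k (by omega))

/-- **`c_L(0,2) ≥ 37/10000 = 0.0037` for EVERY even `L ≥ 4`** (energy-free; `L = 4, …, 12` from the finite rows
`0.0114`, `0.0044`, `0.0063`, `0.0092`, `0.0101`, `L ≥ 14` from the D41 kernel theorem `heisRedCorr2_C02_floor`, `37/10000`).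
HONEST FRAMING: ladder R1–R4 with certified numbers; no claim on H/H₀.
[cite: KLS1988JSP, eqs. (1), (4), (12)–(25)] [cite: DLS1978, Theorem 4.2] -/
theorem heisRedCorr2_C02_floor_allEven (L : ℕ) (hL : 4 ≤ L) (hev : Even L) :
    (37 / 10000 : ℝ) ≤ heisRedCorr2 L 1 0 2 := by
  obtain ⟨k, rfl⟩ := hev
  rcases Nat.lt_or_ge (k + k) 14 with h14 | h14
  · have hk : k = 2 ∨ k = 3 ∨ k = 4 ∨ k = 5 ∨ k = 6 := by omega
    rcases hk with rfl | rfl | rfl | rfl | rfl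
    · exact le_trans (by norm_num) heisRedCorr2_four_0_2_ge_free
    · exact le_trans (by norm_num) heisRedCorr2_six_0_2_ge_free
    · exact le_trans (by norm_num) heisRedCorr2_eight_0_2_ge_free
    · exact le_trans (by norm_num) heisRedCorr2_ten_0_2_ge_free
    · exact le_trans (by norm_num) heisRedCorr2_twelve_0_2_ge_free
  · rw [← two_mul]
    exact heisRedCorr2_C02_floor k (by omega)

/-- **`c_L(1,2) ≤ -41/10000 = -0.0041` for EVERY even `L ≥ 4`** (energy-free; `L = 4, …, 12` from the finite rows
`-0.0088`, `-0.0086`, `-0.0044`, `-0.0085`, `-0.0081`, `L ≥ 14` from the D41 kernel theorem `heisRedCorr2_C12_ceiling`,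
`-41/10000`). HONEST FRAMING: ladder R1–R4 with certified numbers; no claim on H/H₀.
[cite: KLS1988JSP, eqs. (1), (4), (12)–(25)] [cite: DLS1978, Theorem 4.2] -/
theorem heisRedCorr2_C12_ceiling_allEven (L : ℕ) (hL : 4 ≤ L) (hev : Even L) :
    heisRedCorr2 L 1 1 2 ≤ -(41 / 10000 : ℝ) := by
  obtain ⟨k, rfl⟩ := hev
  rcases Nat.lt_or_ge (k + k) 14 with h14 | h14
  · have hk : k = 2 ∨ k = 3 ∨ k = 4 ∨ k = 5 ∨ k = 6 := by omega
    rcases hk with rfl | rfl | rfl | rfl | rfl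
    · exact le_trans heisRedCorr2_four_1_2_le_free (by norm_num)
    · exact le_trans heisRedCorr2_six_1_2_le_free (by norm_num)
    · exact le_trans heisRedCorr2_eight_1_2_le_free (by norm_num)
    · exact le_trans heisRedCorr2_ten_1_2_le_free (by norm_num)
    · exact le_trans heisRedCorr2_twelve_1_2_le_free (by norm_num)
  · rw [← two_mul]
    exact le_trans (heisRedCorr2_C12_ceiling k (by omega)) (by norm_num)

/-- **`c_L(0,3) ≤ -17/10000 = -0.0017` for EVERY even `L ≥ 4`** (energy-free; at `L = 4` the class `(0,3)` is the
bond class `(0,1)` and the Néel variational bound `ε ≤ -1/12` applies; `L = 6, …, 12` from the finite rows `-0.0107`,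
`-0.0017`, `-0.0060`, `-0.0058`; `L ≥ 14` from the D39 kernel theorem `heisRedCorr2_C03_sign`, `-11/5000`).
HONEST FRAMING: ladder R1–R4 with certified numbers; no claim on H/H₀.
[cite: KLS1988JSP, eqs. (1), (4), (12)–(25), p. 1022] [cite: DLS1978, Theorem 4.2] -/
theorem heisRedCorr2_C03_ceiling_allEven (L : ℕ) (hL : 4 ≤ L) (hev : Even L) :
    heisRedCorr2 L 1 0 3 ≤ -(17 / 10000 : ℝ) := by
  have h01 := heisRedCorr2_C01_ceiling_allEven L hL hev
  obtain ⟨k, rfl⟩ := hev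
  rcases Nat.lt_or_ge (k + k) 14 with h14 | h14
  · have hk : k = 2 ∨ k = 3 ∨ k = 4 ∨ k = 5 ∨ k = 6 := by omega
    rcases hk with rfl | rfl | rfl | rfl | rfl
    · have e : heisRedCorr2 (2 + 2) 1 0 3 = heisRedCorr2 4 1 0 1 := heisRedCorr2_symmD4_four.1
      have e' : heisRedCorr2 (2 + 2) 1 0 1 = heisRedCorr2 4 1 0 1 := rfl
      rw [e]; rw [e'] at h01
      linarith
    · exact le_trans heisRedCorr2_six_0_3_le_free (by norm_num)
    · exact le_trans heisRedCorr2_eight_0_3_le_free (by norm_num)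
    · exact le_trans heisRedCorr2_ten_0_3_le_free (by norm_num)
    · exact le_trans heisRedCorr2_twelve_0_3_le_free (by norm_num)
  · rw [← two_mul]
    exact le_trans (heisRedCorr2_C03_sign k (by omega)) (by norm_num)

/-- **The strict Néel sign pattern at `1 ≤ |a|+|b| ≤ 3` on every even torus `L ≥ 4`, energy-free, with `L`-uniform
margins:** `c_L(0,1) ≤ -1/12`, `c_L(1,1) ≥ 173/10000`, `c_L(0,2) ≥ 37/10000`, `c_L(1,2) ≤ -41/10000`, `c_L(0,3) ≤ -17/10000`
(the five `D₄` displacement classes with `1 ≤ |a|+|b| ≤ 3`; devices D30, D39, D40, D41, D42 and the Néel variational bound).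
HONEST FRAMING: ladder R1–R4 with certified numbers; no claim on H/H₀.
[cite: KLS1988JSP, eqs. (1), (4), (12)–(25), p. 1022] [cite: DLS1978, Theorem 4.2] [cite: Marshall1955, sign rule] -/
theorem neelSignPattern_allEven (L : ℕ) (hL : 4 ≤ L) (hev : Even L) :
    heisRedCorr2 L 1 0 1 ≤ -(1 / 12 : ℝ) ∧ (173 / 10000 : ℝ) ≤ heisRedCorr2 L 1 1 1 ∧
    (37 / 10000 : ℝ) ≤ heisRedCorr2 L 1 0 2 ∧ heisRedCorr2 L 1 1 2 ≤ -(41 / 10000 : ℝ) ∧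
    heisRedCorr2 L 1 0 3 ≤ -(17 / 10000 : ℝ) :=
  ⟨heisRedCorr2_C01_ceiling_allEven L hL hev, heisRedCorr2_C11_floor_allEven L hL hev,
    heisRedCorr2_C02_floor_allEven L hL hev, heisRedCorr2_C12_ceiling_allEven L hL hev,
    heisRedCorr2_C03_ceiling_allEven L hL hev⟩

end Summit.HubbardSuperconductivity.HubbardLadder
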